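import Literature.MathematicalPhysics.QuantumFieldTheory.Balaban1983to89.B1DeltaGDerivCutoffPairing
import Literature.MathematicalPhysics.QuantumFieldTheory.Balaban1983to89.B1DeltaGCutoffPairing

/-!
# `Balaban1983to89.B1Cor23RegularNestedFam` — [Balaban1983RegularityDecay] **COROLLARY 2.3 (2.30), BOTH SENTENCES** pp. 580–581, TYPED (`B4.Cor23Printed`,
# b04's carrier `B4.EtaSetting`), **INHABITED BY THE (Higgs)₂,₃ CARRIER AT EVERY VECTOR FIELD (2.23)-REGULAR ON `Ω₀`, FOR ALL NESTED PAIRS OF REGIONS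
# `Ω ⊆ Ω₀ ⊂ T_ε`**: the four pairings of `G^ε_k(Ω,A)` bounded by `c₀e^{−δ₀dist(supp f, supp f′)}‖f‖₂‖f′‖₂` AND the four pairings of
# `δG^ε_k(Ω,Ω₀,A) = G^ε_k(Ω,A) − G^ε_k(Ω₀,A)` bounded by the same times `e^{−δ₀(dist(supp f, Ωᶜ) + dist(supp f′, Ωᶜ))}`, `(c₀, δ₀, e₁)` BEFORE the
# member — the extension of r14 g14's diagonal family `B1Cor23RegularDiagFam` (`Ω₀ = Ω`, `δG = 0`) to the OFF-DIAGONAL pairs, fed by r14 g14/g15's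
# `B1DeltaGCutoffPairing` (plain `δG` pairing, p329907) and `B1DeltaGDerivCutoffPairing` (the three derivative `δG` pairings)

statement-level skeleton of published theorems with citation tags; proofs where landed; nothing here is a claim about the Yang–Mills mass gap

PDF held: `paper:balaban1983-cmp89-regularity-decay` pp. 580–581 [PDF 10–11] (Cor. 2.3), p. 573 [PDF 3] ((1.11)–(1.12)); [Balaban1982Higgs1] =
`paper:balaban1982-cmp85-higgs23-i` p. 605 [PDF 3] (1.7), p. 610 [PDF 8] (2.20)–(2.23).

CITATION HEADER (lean-in-tree rule).  T. Bałaban, *Regularity and decay of lattice Green's functions*, Commun. Math. Phys. **89** (1983) 571–597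
[Balaban1983RegularityDecay], Cor. 2.3 (2.30) pp. 580–581, (1.11) p. 573; T. Bałaban, *(Higgs)₂,₃ quantum fields in a finite volume. I*, Commun. Math.
Phys. **85** (1982) 603–626 [Balaban1982Higgs1], (1.7) p. 605, (2.20), Prop. 2.1 (2.23) p. 610.  Cell `lit-balaban`, reader/typer seat **r14** gen 15
(unit `lit-balaban-r14`; TAKING line HOME/STATUS.md 2026-08-22T14:05:59Z; design note `lit-balaban-r14/DESIGN-deltaG-pairings.md` ADDENDUM steps 4–6);
SKELETON rows **B1.Prop2.3 / B1.Prop2.1** (cells: the `L²`-version of Prop. I.2.1 incl. the `δG`-clause (2.26) at the `G`-level) and r01's **B4.Cor2.3**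
(MODEL-INSTANCE cell only, no head change; decl of record `B4.Cor23Printed` is b04's).  USED BY NAME, never restated: b04 `B4.{EtaSetting, Cor23Printed}`;
r14 g14 `B1Cor23RegularDiagFam.{Cor23Idx, regDiagFam23, suppF, ssdistSteps, ssdistSteps_le, bf, sqrt_bondInner_bf_le, adjA}`,
`B1Cor23RegularRegion.{cor23_first_regular_region, delta_admissible}`, `B1Cor23DerivRegularRegion.cor23_deriv_regular_region`,
`B1Ineq18RegularRegion.{coercive_covOpK_regular_region_uniform, gammaReg_pos}`, `B1Prop22RegularRegionFam.exists_deltaA_of_reg223`,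
`B1Claim18RegularTorusFam.threshold_reg223`, `B1DeltaGCutoffPairing.deltaG_pairing_regular_region` (p329907), r14 g15
`B1DeltaGDerivCutoffPairing.{deltaG_pairing_DG_regular_region, deltaG_pairing_GDt_regular_region, deltaG_pairing_DGDt_regular_region}`,
`B1DeltaGDerivRegularRegion.siteInner_adjA`, `B1DeltaGCutoff.{distTo, exists_distTo_eq}`, `B1Ineq234LevelZero.{tdist_comm, tdist_triangle_real,
tdist_shift_le_one}`, `B1Cor23DerivZeroFieldRegion.bondInner_comm`, `B1Eq230FluctCovPos.siteInner_propagatorK_comm`.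

WHAT IS PRINTED (verbatim, [13] p. 580 [PDF 10] L37ff. and p. 581 [PDF 11] L2): *"Corollary 2.3. If Ω and A are as in Proposition I.2.1, then there exist
positive constants c₀, δ₀ such that for arbitrary scalar field configurations f, f′ defined on Ω, we have |⟨f, G_k(Ω,A)f′⟩|, |⟨f, D^η_{A,μ}G_k(Ω,A)f′⟩|,
|⟨f, G_k(Ω,A)D^{η*}_{A,ν}f′⟩|, |⟨f, D^η_{A,μ}G_k(Ω,A)D^{η*}_{A,ν}f′⟩| ≤ c₀e^{−δ₀dist(supp f, supp f′)}‖f‖₂‖f′‖₂. (2.30) The same inequalities hold for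
δG_k(Ω,Ω₀,A) with the additional factor e^{−δ₀(dist(supp f,Ωᶜ)+dist(supp f′,Ωᶜ))}."*; p. 573 (1.11): *"δG_k(Ω,Ω₀,A) = G_k(Ω,A) − G_k(Ω₀,A)"* for `Ω ⊂ Ω₀`.

THE FAMILY (dictionary of each field of `B4.EtaSetting`).  Index `i` = r14 g14's diagonal index (torus `P` with `P.d = d`, `P.L = L`; level `1 ≤ k ≤ K_P`
with `L^kε ≤ 1`; a region `Ω ⊂ T_ε` that is a union of `k`-fold blocks; a vector field `A`; an effective coupling `e_k`) EXTENDED by a second region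
`Ω₀ ⊇ Ω`, also a union of `k`-fold blocks — the PAIR of the member is `(Ω, Ω₀)`.  All fields are those of `regDiagFam23 … i.toCor23Idx` EXCEPT:
`regular` := (2.23) bond by bond at the sites of `Ω₀` (p35's rescaled form `(L^kε|e|/e_k)|A_μ(z + εe_ν) − A_μ(z)| ≦ c·e_k^{β−1}/L^k`; for `Ω₀ = Ω` this is
the diagonal family's hypothesis); `bdistS f` := `dist(supp f, Ωᶜ)` in `η = L^{−k}`-units (`bdistSteps/L^k`; `0` if `supp f` or `Ωᶜ` is empty); **`dpair n μ ν
f f′`** := the four pairings `|⟨f, δGf′⟩|`, `|⟨h_{f,μ}, D^ε_AδGf′⟩_{bonds}|`, `|⟨f, δGD^{ε*}_Ah_{f′,ν}⟩|`, `|⟨h_{f,μ}, D^ε_AδGD^{ε*}_Ah_{f′,ν}⟩_{bonds}|` of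
`δG = G^ε_k(Ω,A) − G^ε_k(Ω₀,A)` (UNSCALED (2.20), as the `pair`s; `h_{f,μ} = bf Ω μ f` the μ-th component bond field on the bonds inside `Ω`, `D^{ε*}_A = adjA`).

WHAT THIS FILE PROVES (kernel-checked, zero `sorry`; axioms standard).
* §1 `bdistSteps` (+ `bdistSteps_nonneg`, `bdistSteps_le_distTo`); private plumbing (`bf_eq_zero_of_not_inside`, `bf_ne_zero`, `covDeriv_sub`,
  `bondInner_sub_right`).
* §2 `Cor23NestedIdx` (extends `Cor23Idx` by `Ω₀, hΩ₀, hsub`), **`regNestedFam23`** (record update of `regDiagFam23 … i.toCor23Idx`), `regNestedFam23_pair`,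
  `regNestedFam23_dpair` (both `rfl`).
* §3 **`pairT_sub_le`** (`pairT(T₁ − T₂) ≤ pairT T₁ + pairT T₂`), **`pairT_le_of_pairings`** (the four `G^ε_k(Ω′,A)`-pairings of fields on `Ω ⊆ Ω′` from the two
  printed-shape theorems at `Ω′`, constants `(c₁ + c₂)e^{δ₂}`, `min{δ₁, δ₂}` — r14 g14's case analysis, now for any `Ω′ ⊇ Ω`).
* §4 plumbing defs `kbd0`, `kbd1`, `kbd3`, `kbd` (the `M = 1` constants with `a` for `a_k`; private `kbd_facts`, `final_weak`, `pairT_zero`);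
  **`dpairT_le_boundary`**: the four `δG` pairings of a member `≤ kbd·e^{8δ}·e^{−δρ/L^k}e^{−δρ′/L^k}‖f‖‖f′‖` (`ρ, ρ′ = bdistSteps`, `M = 1`, `L^kε ≤ 1`,
  `a_k ≤ a`) from p329907 and `B1DeltaGDerivCutoffPairing`.
* §5 (private `decay_weaken`, `min_decay_le`: `Z ≤ c_Xe^{−p}Q`, `Z ≤ c_Ye^{−q}Q` ⇒ `Z ≤ (c_X + c_Y)e^{−(p+q)/2}Q`) **`cor23Printed_regNestedFam23`**: for `d`,
  `L ≧ 2`, `a > 0`, `m² > 0`, `N`, `(e, q)`, `c ≧ 0`, `β > 0`: `B4.Cor23Printed (regNestedFam23 d L C a m² c β)` — `pair` clauses by §3 at `Ω′ = Ω`; `dpair`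
  clauses by the `min` of §3 at `Ω′ = Ω, Ω₀` (decay in `dist(supp f, supp f′)`) and §4 (decay in the boundary distances), `δ₀ = min{δ₁, δ₂, δ}/2`,
  `c₀ = 3(c₁ + c₂)e^{δ₂} + kbd·e^{8δ}`; the case `Ωᶜ = ∅` (then `Ω₀ = Ω`, `δG = 0`) separately; `regNestedFam23_nonvacuous` (every nested pair carries the
  member `A = 0`).
HONEST SCOPE.  (i) MODEL INSTANCE of the typed (2.30) on the concrete carrier; no head claim on row B4.Cor2.3 (r01's).  (ii) regularity is asked at the
sites of `Ω₀ ⊇ Ω` (the propagator `G_k(Ω₀,A)` of `δG_k` lives on `Ω₀`; print: *"Ω and A as in Proposition I.2.1"*); `Ω, Ω₀` any unions of `k`-fold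
blocks (WEAKER than «unions of big blocks»).  (iii) CURRENCY as in the diagonal family: UNSCALED `ε`-lattice pairings; the proved powers `(L^kε)²,
(L^kε), (L^kε), 1` are absorbed into `c₀` using `L^kε ≤ 1`; distances in lattice steps divided by `L^k`.  (iv) METHOD of the `δG` inputs: cutoff–commutator
(r14 g14/g15), of the `G` inputs: Combes–Thomas — NOT the print's random walk; constants explicit and crude.  (v) `m² > 0` for invertibility; threshold
`d²·c·e_k^β ≦ 1/3`.  (vi) NOT summit progress.
-/

noncomputable section

open scoped BigOperators InnerProductSpace

namespace Literature.MathematicalPhysics.QuantumFieldTheory.Balaban1983to89.B1Cor23RegularNestedFam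

open HiggsLattice HiggsAveraging HiggsCovariance HiggsCovariancePos
open HiggsFluctMeasurePos (siteInner_comm siteInner_sub_right)
open B1Ineq234LevelZero (tdist_comm tdist_triangle_real tdist_shift_le_one)
open B1Cor23RegularRegion (cor23_first_regular_region delta_admissible covDeriv_eq)
open B1Cor23DerivRegularRegion (cor23_deriv_regular_region)
open B1Ineq18RegularRegion (coercive_covOpK_regular_region_uniform gammaReg_pos)
open B1Prop22RegularRegionFam (exists_deltaA_of_reg223)
open B1Claim18RegularTorusFam (threshold_reg223)
open B1Cor23RegularDiagFam (Cor23Idx regDiagFam23 suppF ssdistSteps ssdistSteps_le bf sqrt_bondInner_bf_le adjA)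
open B1DeltaGCutoff (distTo exists_distTo_eq)
open B1DeltaGCutoffPairing (deltaG_pairing_regular_region)
open B1DeltaGDerivCutoffPairing (deltaG_pairing_DG_regular_region deltaG_pairing_GDt_regular_region deltaG_pairing_DGDt_regular_region)
open B1DeltaGDerivRegularRegion (siteInner_adjA)
open B1Cor23DerivZeroFieldRegion (bondInner_comm)
open B1Eq230FluctCovPos (siteInner_propagatorK_comm)
open B4 (EtaSetting Cor23Printed)

variable {P : HiggsLattice.Params} {N : ℕ}

/-! ## §1 The boundary distance of a support and elementary plumbing -/

section Support

open Classical in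
/-- `dist(supp f, Ωᶜ)` in lattice steps of `T_ε` (`0` if `supp f` or `Ωᶜ` is empty). [cite: Balaban1983RegularityDecay, Cor. 2.3 p.581 «dist(supp f, Ωᶜ)»] -/
def bdistSteps (Ω : Finset (HiggsLattice.Site P 0)) (f : ScalarField P 0 N) : ℝ :=
  if h : (suppF f ×ˢ (Finset.univ.filter fun y : HiggsLattice.Site P 0 => y ∉ Ω)).Nonempty then
    (((suppF f ×ˢ (Finset.univ.filter fun y : HiggsLattice.Site P 0 => y ∉ Ω)).inf' h
      fun p => HiggsLattice.Site.tdist p.1 p.2 : ℕ) : ℝ) else 0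

/-- `dist(supp f, Ωᶜ) ≥ 0`. [cite: Balaban1983RegularityDecay, Cor. 2.3 p.581] -/
theorem bdistSteps_nonneg (Ω : Finset (HiggsLattice.Site P 0)) (f : ScalarField P 0 N) : 0 ≤ bdistSteps Ω f := by
  unfold bdistSteps; split_ifs <;> positivity

/-- `dist(supp f, Ωᶜ) ≤ dist(x, Ωᶜ)` for `f(x) ≠ 0` (`Ωᶜ ≠ ∅`). [cite: Balaban1983RegularityDecay, Cor. 2.3 p.581] -/
theorem bdistSteps_le_distTo (Ω : Finset (HiggsLattice.Site P 0)) (f : ScalarField P 0 N)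
    (z₀ : (Finset.univ.filter fun y : HiggsLattice.Site P 0 => y ∉ Ω)) {x : HiggsLattice.Site P 0} (hx : f x ≠ 0) :
    bdistSteps Ω f ≤ (distTo (Finset.univ.filter fun y : HiggsLattice.Site P 0 => y ∉ Ω) z₀ x : ℝ) := by
  classical
  obtain ⟨y, hy, hyeq⟩ := exists_distTo_eq (Finset.univ.filter fun y : HiggsLattice.Site P 0 => y ∉ Ω) z₀ x
  have hmem : (x, y) ∈ suppF f ×ˢ (Finset.univ.filter fun y : HiggsLattice.Site P 0 => y ∉ Ω) := by
    rw [Finset.mem_product]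
    exact ⟨Finset.mem_filter.2 ⟨Finset.mem_univ _, hx⟩, hy⟩
  have hne : (suppF f ×ˢ (Finset.univ.filter fun y : HiggsLattice.Site P 0 => y ∉ Ω)).Nonempty := ⟨_, hmem⟩
  unfold bdistSteps
  rw [dif_pos hne, hyeq]
  exact_mod_cast Finset.inf'_le (fun p : HiggsLattice.Site P 0 × HiggsLattice.Site P 0 => HiggsLattice.Site.tdist p.1 p.2) hmem

/-- `h_{f,μ}` vanishes off the bonds inside `Ω`. [folklore] -/
private theorem bf_eq_zero_of_not_inside (Ω : Finset (HiggsLattice.Site P 0)) (μ : Fin P.d) (f : ScalarField P 0 N)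
    (b : HiggsLattice.PBond P 0) (hb : ¬ Inside Ω b) : bf Ω μ f b = 0 := by
  unfold bf
  rw [if_neg (fun h => hb h.1)]

/-- `h_{f,μ}(b) ≠ 0 ⇒ f(b₋) ≠ 0`. [folklore] -/
private theorem bf_ne_zero {Ω : Finset (HiggsLattice.Site P 0)} {μ : Fin P.d} {f : ScalarField P 0 N} {b : HiggsLattice.PBond P 0}
    (hb : bf Ω μ f b ≠ 0) : f b.src ≠ 0 := by
  unfold bf at hb
  split_ifs at hb with h
  · exact hb
  · exact absurd rfl hb

/-- `D^ε_A(u − w) = D^ε_Au − D^ε_Aw` (`U(A_b)` is linear). [folklore] -/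
private theorem covDeriv_sub (C : ChargeData N) (A : HiggsLattice.VecField P 0) (u w : ScalarField P 0 N) (b : HiggsLattice.PBond P 0) :
    covDeriv C A (u - w) b = covDeriv C A u b - covDeriv C A w b := by
  rw [covDeriv_eq, covDeriv_eq, covDeriv_eq, Pi.sub_apply, Pi.sub_apply, map_sub]
  module

/-- `⟨h, X − Y⟩ = ⟨h, X⟩ − ⟨h, Y⟩` on bonds. [folklore] -/
private theorem bondInner_sub_right (h X Y : HiggsLattice.PBond P 0 → E N) :
    bondInner h (fun b => X b - Y b) = bondInner h X - bondInner h Y := by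
  unfold bondInner
  rw [← Finset.sum_sub_distrib]
  exact Finset.sum_congr rfl fun b _ => by rw [inner_sub_right]; ring

end Support

/-! ## §2 The index set and the family -/

/-- An index of the family: r14 g14's diagonal index (torus, level with `L^kε ≤ 1`, a block-union region `Ω`, vector field, effective coupling) extended
by a second block-union region `Ω₀ ⊇ Ω`; the member's pair of regions is `(Ω, Ω₀)`. [cite: Balaban1983RegularityDecay, §1 (1.11) p.573, Cor. 2.3 pp.580–581] -/
structure Cor23NestedIdx (d L : ℕ) extends Cor23Idx d L where
  /-- the larger region `Ω₀ ⊇ Ω`, a union of `k`-fold blocks -/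
  Ω₀ : Finset (HiggsLattice.Site P 0)
  hΩ₀ : ∀ x x' : HiggsLattice.Site P 0, blockIter k x = blockIter k x' → (x ∈ Ω₀ ↔ x' ∈ Ω₀)
  hsub : Ω ⊆ Ω₀

/-- **THE FAMILY OF `EtaSetting`s OF THE (Higgs)₂,₃ CARRIER FOR COR. 2.3 ON NESTED PAIRS OF REGIONS AT A REGULAR FIELD** (module docstring «THE FAMILY»
for the reading of each field): the diagonal family at `i.toCor23Idx` with `regular` := (2.23) at the sites of `Ω₀`, `bdistS` := `dist(supp ·, Ωᶜ)/L^k`,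
`dpair` := the four pairings of `G^ε_k(Ω,A) − G^ε_k(Ω₀,A)`. [cite: Balaban1983RegularityDecay, Cor. 2.3 (2.30) pp.580–581, (1.11) p.573]
[cite: Balaban1982Higgs1, (2.20)–(2.23) p.610] -/
def regNestedFam23 (d L : ℕ) (C : ChargeData N) (a msq creg β : ℝ) (i : Cor23NestedIdx d L) : EtaSetting :=
  { regDiagFam23 d L C a msq creg β i.toCor23Idx with
    regular := ∀ z ∈ i.Ω₀, ∀ μ ν : Fin i.P.d,
      i.P.mesh i.k * |C.e| / i.ec * |i.A ⟨z.shift ν, μ⟩ - i.A ⟨z, μ⟩| ≤ creg * i.ec ^ (β - 1) / (i.P.L : ℝ) ^ i.k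
    bdistS := fun f => bdistSteps i.Ω f.1 / (i.P.L : ℝ) ^ i.k
    dpair := fun n μ ν f f' =>
      i.toCor23Idx.pairT C (i.toCor23Idx.G C a msq - propagatorK C i.Ω₀ i.A msq a i.k) n μ ν f f' }

/-- unfolding `pair`. [cite: Balaban1983RegularityDecay, Cor. 2.3 (2.30) p.580] -/
theorem regNestedFam23_pair (d L : ℕ) (C : ChargeData N) (a msq creg β : ℝ) (i : Cor23NestedIdx d L) (n : Fin 4)
    (μ ν : (regNestedFam23 d L C a msq creg β i).Dir) (f f' : (regNestedFam23 d L C a msq creg β i).Src) :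
    (regNestedFam23 d L C a msq creg β i).pair n μ ν f f' = i.toCor23Idx.pairT C (propagatorK C i.Ω i.A msq a i.k) n μ ν f f' := rfl

/-- unfolding `dpair`. [cite: Balaban1983RegularityDecay, Cor. 2.3 p.581, (1.11) p.573] -/
theorem regNestedFam23_dpair (d L : ℕ) (C : ChargeData N) (a msq creg β : ℝ) (i : Cor23NestedIdx d L) (n : Fin 4)
    (μ ν : (regNestedFam23 d L C a msq creg β i).Dir) (f f' : (regNestedFam23 d L C a msq creg β i).Src) :
    (regNestedFam23 d L C a msq creg β i).dpair n μ ν f f'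
      = i.toCor23Idx.pairT C (propagatorK C i.Ω i.A msq a i.k - propagatorK C i.Ω₀ i.A msq a i.k) n μ ν f f' := rfl

/-! ## §3 The four pairings of `G^ε_k(Ω′,A)` for fields on `Ω ⊆ Ω′`, and the difference of two operators -/

section Pairings

variable {d L : ℕ}

/-- **`pairT(T₁ − T₂) ≤ pairT T₁ + pairT T₂`** for each of the four pairings (linearity of `D^ε_A` and of the scalar products).
[cite: Balaban1983RegularityDecay, (1.11) p.573, Cor. 2.3 (2.30) p.580] -/
theorem pairT_sub_le (i : Cor23Idx d L) (C : ChargeData N) (T₁ T₂ : ScalarField i.P 0 N →ₗ[ℝ] ScalarField i.P 0 N) (n : Fin 4)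
    (μ ν : Fin i.P.d) (f f' : i.SrcΩ N) :
    i.pairT C (T₁ - T₂) n μ ν f f' ≤ i.pairT C T₁ n μ ν f f' + i.pairT C T₂ n μ ν f f' := by
  have hD : ∀ u w : ScalarField i.P 0 N, covDeriv C i.A (u - w) = fun b => covDeriv C i.A u b - covDeriv C i.A w b :=
    fun u w => funext fun b => covDeriv_sub C i.A u w b
  match n with
  | 0 =>
    simp only [Cor23Idx.pairT, LinearMap.sub_apply, siteInner_sub_right]
    exact abs_sub _ _
  | 1 =>
    simp only [Cor23Idx.pairT, LinearMap.sub_apply, hD, bondInner_sub_right]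
    exact abs_sub _ _
  | 2 =>
    simp only [Cor23Idx.pairT, LinearMap.sub_apply, siteInner_sub_right]
    exact abs_sub _ _
  | 3 =>
    simp only [Cor23Idx.pairT, LinearMap.sub_apply, hD, bondInner_sub_right]
    exact abs_sub _ _

set_option maxHeartbeats 800000 in
/-- **THE FOUR PAIRINGS OF `G^ε_k(Ω′,A)` FOR FIELDS ON `Ω ⊆ Ω′`** from the two printed-shape pairing theorems AT `Ω′` (first pairing with `(δ₁, c₁)`, the
three derivative pairings with `(δ₂, c₂)`, in the shapes of `B1Cor23RegularRegion.cor23_first_regular_region` / `B1Cor23DerivRegularRegion.cor23_deriv_regular_region`):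
`pairT(G^ε_k(Ω′,A)) n ≤ (c₁ + c₂)e^{δ₂}·e^{−min{δ₁,δ₂}dist(supp f, supp f′)/L^k}‖f‖‖f′‖` — r14 g14's case analysis (`B1Cor23RegularDiagFam`), for any `Ω′ ⊇ Ω`
(the component bond fields of `f, f′` live on the bonds inside `Ω`, the sources in `Ω`). [cite: Balaban1983RegularityDecay, Cor. 2.3 (2.30) p.580] -/
theorem pairT_le_of_pairings (i : Cor23Idx d L) (C : ChargeData N) (a msq : ℝ) (Ω' : Finset (HiggsLattice.Site i.P 0)) (hsub : i.Ω ⊆ Ω')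
    {δ₁ c₁ δ₂ c₂ : ℝ} (hc₁ : 0 < c₁) (hδ₂ : 0 < δ₂) (hc₂ : 0 < c₂)
    (H1i : ∀ (r : ℝ) (g g' : ScalarField i.P 0 N), (∀ x, x ∉ Ω' → g' x = 0) →
      (∀ x x', g x ≠ 0 → g' x' ≠ 0 → r ≤ (HiggsLattice.Site.tdist x x' : ℝ)) →
        |siteInner g (propagatorK C Ω' i.A msq a i.k g')| ≤
          c₁ * Real.exp (-(δ₁ * (r / (i.P.L : ℝ) ^ i.k))) * Real.sqrt (siteInner g g) * Real.sqrt (siteInner g' g'))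
    (H2i : ∀ (r : ℝ),
      (∀ (h : HiggsLattice.PBond i.P 0 → E N) (g' : ScalarField i.P 0 N), (∀ b, ¬ Inside Ω' b → h b = 0) →
        (∀ (b : HiggsLattice.PBond i.P 0) (x' : HiggsLattice.Site i.P 0), h b ≠ 0 → g' x' ≠ 0 →
          r ≤ (HiggsLattice.Site.tdist b.src x' : ℝ)) →
        |bondInner h (covDeriv C i.A (propagatorK C Ω' i.A msq a i.k g'))|
          ≤ c₂ * Real.exp (-(δ₂ * (r / (i.P.L : ℝ) ^ i.k))) * Real.sqrt (bondInner h h) * Real.sqrt (siteInner g' g'))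
      ∧ (∀ (g : ScalarField i.P 0 N) (h : HiggsLattice.PBond i.P 0 → E N), (∀ b, ¬ Inside Ω' b → h b = 0) →
        (∀ (b : HiggsLattice.PBond i.P 0) (x : HiggsLattice.Site i.P 0), h b ≠ 0 → g x ≠ 0 →
          r ≤ (HiggsLattice.Site.tdist b.src x : ℝ)) →
        |siteInner g (propagatorK C Ω' i.A msq a i.k
            (fun x => (i.P.mesh 0)⁻¹ • ∑ ν : Fin i.P.d,
              (star (C.U (i.P.mesh 0) (i.A ⟨x.unshift ν, ν⟩)) (h ⟨x.unshift ν, ν⟩) - h ⟨x, ν⟩)))|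
          ≤ c₂ * Real.exp (-(δ₂ * (r / (i.P.L : ℝ) ^ i.k))) * Real.sqrt (siteInner g g) * Real.sqrt (bondInner h h))
      ∧ (∀ (h h' : HiggsLattice.PBond i.P 0 → E N), (∀ b, ¬ Inside Ω' b → h b = 0) →
        (∀ b, ¬ Inside Ω' b → h' b = 0) →
        (∀ b b' : HiggsLattice.PBond i.P 0, h b ≠ 0 → h' b' ≠ 0 →
          r ≤ (HiggsLattice.Site.tdist b.src b'.src : ℝ) ∧ r ≤ (HiggsLattice.Site.tdist b.src b'.tgt : ℝ)) →
        |bondInner h (covDeriv C i.A (propagatorK C Ω' i.A msq a i.k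
            (fun x => (i.P.mesh 0)⁻¹ • ∑ ν : Fin i.P.d,
              (star (C.U (i.P.mesh 0) (i.A ⟨x.unshift ν, ν⟩)) (h' ⟨x.unshift ν, ν⟩) - h' ⟨x, ν⟩))))|
          ≤ c₂ * Real.exp (-(δ₂ * (r / (i.P.L : ℝ) ^ i.k))) * Real.sqrt (bondInner h h) *
            Real.sqrt (bondInner h' h')))
    (n : Fin 4) (μ ν : Fin i.P.d) (f f' : i.SrcΩ N) :
    i.pairT C (propagatorK C Ω' i.A msq a i.k) n μ ν f f'
      ≤ (c₁ + c₂) * Real.exp δ₂ * Real.exp (-(min δ₁ δ₂ * (ssdistSteps f.1 f'.1 / (i.P.L : ℝ) ^ i.k)))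
        * Real.sqrt (siteInner f.1 f.1) * Real.sqrt (siteInner f'.1 f'.1) := by
  have hLk : (1 : ℝ) ≤ (i.P.L : ℝ) ^ i.k := by exact_mod_cast Nat.one_le_pow _ _ i.P.hL
  have hLpos : (0 : ℝ) < (i.P.L : ℝ) ^ i.k := by linarith
  have hf'Ω' : ∀ x, x ∉ Ω' → f'.1 x = 0 := fun x hx => f'.2 x (fun h => hx (hsub h))
  have hbfΩ' : ∀ (μ' : Fin i.P.d) (φ : ScalarField i.P 0 N) (b : HiggsLattice.PBond i.P 0), ¬ Inside Ω' b → bf i.Ω μ' φ b = 0 :=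
    fun μ' φ b hb => bf_eq_zero_of_not_inside i.Ω μ' φ b (fun hin => hb ⟨hsub hin.1, hsub hin.2⟩)
  set s : ℝ := ssdistSteps f.1 f'.1 with hs_def
  have hs0 : 0 ≤ s := by
    rw [hs_def]; unfold ssdistSteps; split_ifs <;> positivity
  have hF := Real.sqrt_nonneg (siteInner f.1 f.1)
  have hF' := Real.sqrt_nonneg (siteInner f'.1 f'.1)
  -- the common weakening `c e^{−δ s/L^k} ≤ c₀ e^{−min δ · s/L^k}`
  have weak : ∀ {c δ : ℝ}, 0 ≤ c → c ≤ (c₁ + c₂) * Real.exp δ₂ → min δ₁ δ₂ ≤ δ →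
      ∀ {X : ℝ}, 0 ≤ X → c * Real.exp (-(δ * (s / (i.P.L : ℝ) ^ i.k))) * X
        ≤ (c₁ + c₂) * Real.exp δ₂ * Real.exp (-(min δ₁ δ₂ * (s / (i.P.L : ℝ) ^ i.k))) * X := by
    intro c δ hc0 hcle hδle X hX
    have hsq : 0 ≤ s / (i.P.L : ℝ) ^ i.k := div_nonneg hs0 hLpos.le
    have h1 : Real.exp (-(δ * (s / (i.P.L : ℝ) ^ i.k))) ≤ Real.exp (-(min δ₁ δ₂ * (s / (i.P.L : ℝ) ^ i.k))) :=
      Real.exp_le_exp.2 (by nlinarith)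
    have h2 : c * Real.exp (-(δ * (s / (i.P.L : ℝ) ^ i.k)))
        ≤ (c₁ + c₂) * Real.exp δ₂ * Real.exp (-(min δ₁ δ₂ * (s / (i.P.L : ℝ) ^ i.k))) :=
      (mul_le_mul_of_nonneg_right hcle (Real.exp_nonneg _)).trans
        (mul_le_mul_of_nonneg_left h1 (by positivity))
    exact mul_le_mul_of_nonneg_right h2 hX
  have hE2 : 1 ≤ Real.exp δ₂ := Real.one_le_exp hδ₂.le
  have hc₁le : c₁ ≤ (c₁ + c₂) * Real.exp δ₂ := by nlinarith
  have hc₂le : c₂ ≤ (c₁ + c₂) * Real.exp δ₂ := by nlinarith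
  have hc₂e : c₂ * Real.exp δ₂ ≤ (c₁ + c₂) * Real.exp δ₂ := by nlinarith [Real.exp_pos δ₂]
  -- `e^{−δ₂(s−1)/L^k} ≤ e^{δ₂}e^{−δ₂ s/L^k}` (used for the fourth pairing)
  have hexp : Real.exp (-(δ₂ * ((s - 1) / (i.P.L : ℝ) ^ i.k))) ≤ Real.exp δ₂ * Real.exp (-(δ₂ * (s / (i.P.L : ℝ) ^ i.k))) := by
    rw [← Real.exp_add]
    apply Real.exp_le_exp.2
    have h1 : δ₂ * ((s - 1) / (i.P.L : ℝ) ^ i.k) = δ₂ * (s / (i.P.L : ℝ) ^ i.k) - δ₂ / (i.P.L : ℝ) ^ i.k := by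
      rw [sub_div, mul_sub, mul_one_div]
    have h2 : δ₂ / (i.P.L : ℝ) ^ i.k ≤ δ₂ := div_le_self hδ₂.le hLk
    linarith
  match n with
  | 0 =>
    simp only [Cor23Idx.pairT]
    have hsep : ∀ x x', f.1 x ≠ 0 → f'.1 x' ≠ 0 → s ≤ (HiggsLattice.Site.tdist x x' : ℝ) :=
      fun x x' hx hx' => ssdistSteps_le hx hx'
    have h := H1i s f.1 f'.1 hf'Ω' hsep
    calc _ ≤ _ := h
      _ = c₁ * Real.exp (-(δ₁ * (s / (i.P.L : ℝ) ^ i.k))) * (Real.sqrt (siteInner f.1 f.1) * Real.sqrt (siteInner f'.1 f'.1)) := by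
          ring
      _ ≤ (c₁ + c₂) * Real.exp δ₂ * Real.exp (-(min δ₁ δ₂ * (s / (i.P.L : ℝ) ^ i.k))) *
            (Real.sqrt (siteInner f.1 f.1) * Real.sqrt (siteInner f'.1 f'.1)) :=
          weak hc₁.le hc₁le (min_le_left _ _) (mul_nonneg hF hF')
      _ = _ := by ring
  | 1 =>
    simp only [Cor23Idx.pairT]
    have hsep : ∀ (b : HiggsLattice.PBond i.P 0) (x' : HiggsLattice.Site i.P 0), bf i.Ω μ f.1 b ≠ 0 → f'.1 x' ≠ 0 →
        s ≤ (HiggsLattice.Site.tdist b.src x' : ℝ) := fun b x' hb hx' => ssdistSteps_le (bf_ne_zero hb) hx'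
    have h := (H2i s).1 (bf i.Ω μ f.1) f'.1 (hbfΩ' μ f.1) hsep
    have hb := sqrt_bondInner_bf_le i.Ω μ f.1
    calc _ ≤ _ := h
      _ ≤ c₂ * Real.exp (-(δ₂ * (s / (i.P.L : ℝ) ^ i.k))) * Real.sqrt (siteInner f.1 f.1) * Real.sqrt (siteInner f'.1 f'.1) := by
          have := mul_le_mul_of_nonneg_right (mul_le_mul_of_nonneg_left hb
            (show 0 ≤ c₂ * Real.exp (-(δ₂ * (s / (i.P.L : ℝ) ^ i.k))) by positivity)) hF'
          exact this
      _ = c₂ * Real.exp (-(δ₂ * (s / (i.P.L : ℝ) ^ i.k))) * (Real.sqrt (siteInner f.1 f.1) * Real.sqrt (siteInner f'.1 f'.1)) := by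
          ring
      _ ≤ (c₁ + c₂) * Real.exp δ₂ * Real.exp (-(min δ₁ δ₂ * (s / (i.P.L : ℝ) ^ i.k))) *
            (Real.sqrt (siteInner f.1 f.1) * Real.sqrt (siteInner f'.1 f'.1)) :=
          weak hc₂.le hc₂le (min_le_right _ _) (mul_nonneg hF hF')
      _ = _ := by ring
  | 2 =>
    simp only [Cor23Idx.pairT]
    have hsep : ∀ (b : HiggsLattice.PBond i.P 0) (x : HiggsLattice.Site i.P 0), bf i.Ω ν f'.1 b ≠ 0 → f.1 x ≠ 0 →
        s ≤ (HiggsLattice.Site.tdist b.src x : ℝ) := by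
      intro b x hb hx
      have h1 := ssdistSteps_le hx (bf_ne_zero hb)
      rwa [tdist_comm] at h1
    have h := (H2i s).2.1 f.1 (bf i.Ω ν f'.1) (hbfΩ' ν f'.1) hsep
    have hb := sqrt_bondInner_bf_le i.Ω ν f'.1
    unfold adjA
    calc _ ≤ _ := h
      _ ≤ c₂ * Real.exp (-(δ₂ * (s / (i.P.L : ℝ) ^ i.k))) * Real.sqrt (siteInner f.1 f.1) * Real.sqrt (siteInner f'.1 f'.1) :=
          mul_le_mul_of_nonneg_left hb (by positivity)
      _ = c₂ * Real.exp (-(δ₂ * (s / (i.P.L : ℝ) ^ i.k))) * (Real.sqrt (siteInner f.1 f.1) * Real.sqrt (siteInner f'.1 f'.1)) := by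
          ring
      _ ≤ (c₁ + c₂) * Real.exp δ₂ * Real.exp (-(min δ₁ δ₂ * (s / (i.P.L : ℝ) ^ i.k))) *
            (Real.sqrt (siteInner f.1 f.1) * Real.sqrt (siteInner f'.1 f'.1)) :=
          weak hc₂.le hc₂le (min_le_right _ _) (mul_nonneg hF hF')
      _ = _ := by ring
  | 3 =>
    simp only [Cor23Idx.pairT]
    -- separation `s − 1` (the far endpoint of the source bond may be one step closer)
    have hsep : ∀ b b' : HiggsLattice.PBond i.P 0, bf i.Ω μ f.1 b ≠ 0 → bf i.Ω ν f'.1 b' ≠ 0 →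
        s - 1 ≤ (HiggsLattice.Site.tdist b.src b'.src : ℝ) ∧ s - 1 ≤ (HiggsLattice.Site.tdist b.src b'.tgt : ℝ) := by
      intro b b' hb hb'
      have h1 : s ≤ (HiggsLattice.Site.tdist b.src b'.src : ℝ) := ssdistSteps_le (bf_ne_zero hb) (bf_ne_zero hb')
      have h2 : (HiggsLattice.Site.tdist b.src b'.src : ℝ)
          ≤ (HiggsLattice.Site.tdist b.src b'.tgt : ℝ) + (HiggsLattice.Site.tdist b'.tgt b'.src : ℝ) := tdist_triangle_real _ _ _
      have h3 : (HiggsLattice.Site.tdist b'.tgt b'.src : ℝ) ≤ 1 := by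
        rw [tdist_comm]
        exact_mod_cast tdist_shift_le_one b'.src b'.dir
      constructor <;> linarith
    have h := (H2i (s - 1)).2.2 (bf i.Ω μ f.1) (bf i.Ω ν f'.1) (hbfΩ' μ f.1) (hbfΩ' ν f'.1) hsep
    have hb := sqrt_bondInner_bf_le i.Ω μ f.1
    have hb' := sqrt_bondInner_bf_le i.Ω ν f'.1
    have hbb := Real.sqrt_nonneg (bondInner (bf i.Ω ν f'.1) (bf i.Ω ν f'.1))
    unfold adjA
    calc _ ≤ _ := h
      _ ≤ c₂ * (Real.exp δ₂ * Real.exp (-(δ₂ * (s / (i.P.L : ℝ) ^ i.k)))) *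
            Real.sqrt (siteInner f.1 f.1) * Real.sqrt (siteInner f'.1 f'.1) := by
          have step1 := mul_le_mul_of_nonneg_left hexp hc₂.le
          have step2 : c₂ * Real.exp (-(δ₂ * ((s - 1) / (i.P.L : ℝ) ^ i.k))) * Real.sqrt (bondInner (bf i.Ω μ f.1) (bf i.Ω μ f.1))
              ≤ c₂ * (Real.exp δ₂ * Real.exp (-(δ₂ * (s / (i.P.L : ℝ) ^ i.k)))) * Real.sqrt (siteInner f.1 f.1) :=
            mul_le_mul step1 hb (Real.sqrt_nonneg _) (by positivity)
          exact mul_le_mul step2 hb' hbb (by positivity)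
      _ = c₂ * Real.exp δ₂ * Real.exp (-(δ₂ * (s / (i.P.L : ℝ) ^ i.k))) *
            (Real.sqrt (siteInner f.1 f.1) * Real.sqrt (siteInner f'.1 f'.1)) := by ring
      _ ≤ (c₁ + c₂) * Real.exp δ₂ * Real.exp (-(min δ₁ δ₂ * (s / (i.P.L : ℝ) ^ i.k))) *
            (Real.sqrt (siteInner f.1 f.1) * Real.sqrt (siteInner f'.1 f'.1)) :=
          weak (by positivity) hc₂e (min_le_right _ _) (mul_nonneg hF hF')
      _ = _ := by ring

end Pairings

/-! ## §4 The four `δG_k(Ω,Ω₀,A)` pairings of a member with the boundary decay -/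

section Boundary

variable {d L : ℕ}

/-- the `n = 0` constant of `B1DeltaGCutoffPairing` at `M = 1` (with `a` in place of `a_k`; plumbing for the printed `c₀`).
[cite: Balaban1983RegularityDecay, Cor. 2.3 p.581] -/
def kbd0 (γ : ℝ) (dd : ℕ) (δ a : ℝ) : ℝ :=
  4 / γ + 2 * Real.sqrt dd * (2 / Real.sqrt γ + 4 * Real.sqrt dd * δ / γ) * (2 / γ) * Real.exp δ + 2 * a * (2 / γ) ^ 2

/-- the `n = 1, 2` constant of `B1DeltaGDerivCutoffPairing` at `M = 1` (with `a` in place of `a_k`; plumbing for the printed `c₀`).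
[cite: Balaban1983RegularityDecay, Cor. 2.3 p.581] -/
def kbd1 (γ : ℝ) (dd : ℕ) (δ a : ℝ) : ℝ :=
  (2 / Real.sqrt γ + 4 * Real.sqrt dd * δ / γ) * (Real.exp δ + Real.exp δ ^ 3)
    + Real.sqrt dd *
      (Real.exp δ ^ 2 * ((4 + 2 * δ * Real.sqrt (8 * dd / γ)) * (2 / γ) + (2 / Real.sqrt γ + 4 * Real.sqrt dd * δ / γ) ^ 2) + 2 / γ)
    + 2 * a * (2 / Real.sqrt γ + 4 * Real.sqrt dd * δ / γ) * Real.exp δ * (2 / γ)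

/-- the `n = 3` constant of `B1DeltaGDerivCutoffPairing` at `M = 1` (with `a` in place of `a_k`; plumbing for the printed `c₀`).
[cite: Balaban1983RegularityDecay, Cor. 2.3 p.581] -/
def kbd3 (γ : ℝ) (dd : ℕ) (δ a : ℝ) : ℝ :=
  (4 + 2 * δ * Real.sqrt (8 * dd / γ)) * (Real.exp δ ^ 3 + Real.exp δ ^ 4)
    + Real.sqrt dd * (2 / Real.sqrt γ + 4 * Real.sqrt dd * δ / γ) * Real.exp δ * (2 * (4 + 2 * δ * Real.sqrt (8 * dd / γ)) * Real.exp δ ^ 2 + 2)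
    + 2 * a * (2 / Real.sqrt γ + 4 * Real.sqrt dd * δ / γ) ^ 2 * Real.exp δ ^ 2

/-- the common constant of the boundary bounds of the four `δG` pairings (plumbing for the printed `c₀`). [cite: Balaban1983RegularityDecay, Cor. 2.3 p.581] -/
def kbd (γ : ℝ) (dd : ℕ) (δ a : ℝ) : ℝ := kbd0 γ dd δ a + kbd1 γ dd δ a + kbd3 γ dd δ a

/-- nonnegativity and monotonicity of the constants. [folklore] -/
private theorem kbd_facts {γ : ℝ} (hγ : 0 < γ) (dd : ℕ) {δ : ℝ} (hδ : 0 ≤ δ) {a a' : ℝ} (ha : 0 ≤ a) (haa : a ≤ a') :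
    0 ≤ kbd0 γ dd δ a ∧ 0 ≤ kbd1 γ dd δ a ∧ 0 ≤ kbd3 γ dd δ a ∧
    kbd0 γ dd δ a ≤ kbd γ dd δ a' ∧ kbd1 γ dd δ a ≤ kbd γ dd δ a' ∧ kbd3 γ dd δ a ≤ kbd γ dd δ a' := by
  have hcD : 0 ≤ 2 / Real.sqrt γ + 4 * Real.sqrt dd * δ / γ := by positivity
  have hc₂ : 0 ≤ 4 + 2 * δ * Real.sqrt (8 * dd / γ) := by positivity
  have hE : 0 ≤ Real.exp δ := (Real.exp_pos δ).le
  have h0 : 0 ≤ kbd0 γ dd δ a := by unfold kbd0; positivity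
  have h1 : 0 ≤ kbd1 γ dd δ a := by unfold kbd1; positivity
  have h3 : 0 ≤ kbd3 γ dd δ a := by unfold kbd3; positivity
  have m0 : kbd0 γ dd δ a ≤ kbd0 γ dd δ a' := by
    unfold kbd0
    have : 2 * a * (2 / γ) ^ 2 ≤ 2 * a' * (2 / γ) ^ 2 := by nlinarith [sq_nonneg (2 / γ)]
    linarith
  have m1 : kbd1 γ dd δ a ≤ kbd1 γ dd δ a' := by
    unfold kbd1
    have : 2 * a * (2 / Real.sqrt γ + 4 * Real.sqrt dd * δ / γ) * Real.exp δ * (2 / γ)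
        ≤ 2 * a' * (2 / Real.sqrt γ + 4 * Real.sqrt dd * δ / γ) * Real.exp δ * (2 / γ) := by
      have hq : 0 ≤ (2 / Real.sqrt γ + 4 * Real.sqrt dd * δ / γ) * Real.exp δ * (2 / γ) := by positivity
      nlinarith
    linarith
  have m3 : kbd3 γ dd δ a ≤ kbd3 γ dd δ a' := by
    unfold kbd3
    have : 2 * a * (2 / Real.sqrt γ + 4 * Real.sqrt dd * δ / γ) ^ 2 * Real.exp δ ^ 2
        ≤ 2 * a' * (2 / Real.sqrt γ + 4 * Real.sqrt dd * δ / γ) ^ 2 * Real.exp δ ^ 2 := by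
      have hq : 0 ≤ (2 / Real.sqrt γ + 4 * Real.sqrt dd * δ / γ) ^ 2 * Real.exp δ ^ 2 := by positivity
      nlinarith
    linarith
  have h0' : 0 ≤ kbd0 γ dd δ a' := by unfold kbd0; have := le_trans ha haa; positivity
  have h1' : 0 ≤ kbd1 γ dd δ a' := by unfold kbd1; have := le_trans ha haa; positivity
  have h3' : 0 ≤ kbd3 γ dd δ a' := by unfold kbd3; have := le_trans ha haa; positivity
  refine ⟨h0, h1, h3, ?_, ?_, ?_⟩ <;> unfold kbd <;> linarith

/-- the final weakening step of each boundary bound. [folklore] -/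
private theorem final_weak {K K₂ T p e e' X X₂ Y Y₂ : ℝ} (hK0 : 0 ≤ K) (hK : K ≤ K₂) (hT : 0 ≤ T) (hp0 : 0 ≤ p) (hp : p ≤ 1)
    (he : 0 ≤ e) (he' : 0 ≤ e') (hX0 : 0 ≤ X) (hX : X ≤ X₂) (hY0 : 0 ≤ Y) (hY : Y ≤ Y₂) :
    K * T * p * e * e' * X * Y ≤ K₂ * T * e * e' * X₂ * Y₂ := by
  have hK₂ : 0 ≤ K₂ := hK0.trans hK
  have hX₂ : 0 ≤ X₂ := hX0.trans hX
  calc K * T * p * e * e' * X * Y ≤ K₂ * T * 1 * e * e' * X₂ * Y₂ := by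
        gcongr
    _ = K₂ * T * e * e' * X₂ * Y₂ := by ring

/-- The pairings of the zero operator vanish. [folklore] -/
private theorem pairT_zero (i : Cor23Idx d L) (C : ChargeData N) (n : Fin 4) (μ ν : Fin i.P.d) (f f' : i.SrcΩ N) :
    i.pairT C (0 : ScalarField i.P 0 N →ₗ[ℝ] ScalarField i.P 0 N) n μ ν f f' = 0 := by
  have hcov : ∀ b : HiggsLattice.PBond i.P 0, covDeriv C i.A (0 : ScalarField i.P 0 N) b = 0 := by
    intro b
    rw [covDeriv_eq]
    simp
  have hb0 : ∀ h : HiggsLattice.PBond i.P 0 → E N, bondInner h (covDeriv C i.A (0 : ScalarField i.P 0 N)) = 0 := by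
    intro h
    unfold bondInner
    exact Finset.sum_eq_zero fun b _ => by rw [hcov b, inner_zero_right, mul_zero]
  have hs0 : ∀ g : ScalarField i.P 0 N, siteInner g (0 : ScalarField i.P 0 N) = 0 := by
    intro g
    unfold siteInner
    exact Finset.sum_eq_zero fun x _ => by rw [Pi.zero_apply, inner_zero_right, mul_zero]
  match n with
  | 0 => simp only [Cor23Idx.pairT, LinearMap.zero_apply, hs0, abs_zero]
  | 1 => simp only [Cor23Idx.pairT, LinearMap.zero_apply, hb0, abs_zero]
  | 2 => simp only [Cor23Idx.pairT, LinearMap.zero_apply, hs0, abs_zero]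
  | 3 => simp only [Cor23Idx.pairT, LinearMap.zero_apply, hb0, abs_zero]

set_option maxHeartbeats 1600000 in
/-- **THE FOUR `δG^ε_k(Ω,Ω₀,A)` PAIRINGS OF A MEMBER WITH THE BOUNDARY DECAY** (the `L²` second sentence of Cor. 2.3 before the joint decay): for a
member with `Ωᶜ ≠ ∅` (a point `z₀ ∉ Ω`), `a > 0`, `L > 1`, `m² > 0`, (2.20)-coercivity `γ` at `A` on the `Ω`- and on the `Ω₀`-supported fields and an
admissible `δ`, every `n`, all directions and all `f, f′` on `Ω`:
`dpairT n ≤ kbd(γ, d, δ, a)·e^{8δ}·e^{−δdist(supp f,Ωᶜ)/L^k}e^{−δdist(supp f′,Ωᶜ)/L^k}‖f‖‖f′‖` (the four theorems `B1DeltaGCutoffPairing.deltaG_pairing_regular_region`,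
`B1DeltaGDerivCutoffPairing.deltaG_pairing_{DG,GDt,DGDt}_regular_region` at `M = 1`, `ρ = dist(supp ·, Ωᶜ)`, with `L^kε ≤ 1`, `a_k ≤ a`, `‖h_{f,μ}‖ ≤ ‖f‖`).
[cite: Balaban1983RegularityDecay, Cor. 2.3 p.581, (1.11) p.573] -/
theorem dpairT_le_boundary (i : Cor23NestedIdx d L) (C : ChargeData N) {a msq : ℝ} (ha : 0 < a) (hL1 : 1 < i.P.L) (hmsq : 0 < msq)
    {γ : ℝ} (hγ : 0 < γ)
    (hlow : ∀ w : ScalarField i.P 0 N, (∀ x, x ∉ i.Ω → w x = 0) →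
      γ * ((i.P.mesh i.k)⁻¹ ^ 2) * siteInner w w ≤ siteInner w (covOpK C i.Ω i.A msq a i.k w))
    (hlow₀ : ∀ w : ScalarField i.P 0 N, (∀ x, x ∉ i.Ω₀ → w x = 0) →
      γ * ((i.P.mesh i.k)⁻¹ ^ 2) * siteInner w w ≤ siteInner w (covOpK C i.Ω₀ i.A msq a i.k w))
    {δ : ℝ} (hδ0 : 0 ≤ δ) (hδ1 : δ ≤ 1) (hδ : 2 * (2 * i.P.d * δ ^ 2 + B1.aSeq a i.P.L i.k * (2 * δ)) ≤ γ)
    (z₀ : (Finset.univ.filter fun y : HiggsLattice.Site i.P 0 => y ∉ i.Ω))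
    (n : Fin 4) (μ ν : Fin i.P.d) (f f' : i.toCor23Idx.SrcΩ N) :
    i.toCor23Idx.pairT C (propagatorK C i.Ω i.A msq a i.k - propagatorK C i.Ω₀ i.A msq a i.k) n μ ν f f'
      ≤ kbd γ i.P.d δ a * Real.exp (8 * δ)
        * Real.exp (-(δ * (bdistSteps i.Ω f.1 / (i.P.L : ℝ) ^ i.k))) * Real.exp (-(δ * (bdistSteps i.Ω f'.1 / (i.P.L : ℝ) ^ i.k)))
        * Real.sqrt (siteInner f.1 f.1) * Real.sqrt (siteInner f'.1 f'.1) := by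
  have hL' : (1 : ℝ) < (i.P.L : ℝ) := by exact_mod_cast hL1
  have hak : 0 ≤ B1.aSeq a i.P.L i.k := (B1.aSeq_pos ha hL' i.hk1).le
  have hak_le : B1.aSeq a i.P.L i.k ≤ a := B1.aSeq_le ha hL' i.k i.hk1
  have hM0 : 0 ≤ i.P.mesh i.k := (i.P.mesh_pos i.k).le
  have hM1 : i.P.mesh i.k ≤ 1 := i.hs
  have hM2 : i.P.mesh i.k ^ 2 ≤ 1 := by nlinarith
  obtain ⟨hk0, hk1, hk3, hk0le, hk1le, hk3le⟩ := kbd_facts hγ i.P.d hδ0 hak hak_le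
  have hT : Real.exp (2 * (δ * (((1 : ℕ) : ℝ) + 3))) = Real.exp (8 * δ) := by
    congr 1; push_cast; ring
  have hT0 : 0 ≤ Real.exp (8 * δ) := (Real.exp_pos _).le
  set ρ := bdistSteps i.Ω f.1 with hρ
  set ρ' := bdistSteps i.Ω f'.1 with hρ'
  have hρf : ∀ x, f.1 x ≠ 0 → ρ ≤ (distTo (Finset.univ.filter fun y : HiggsLattice.Site i.P 0 => y ∉ i.Ω) z₀ x : ℝ) :=
    fun x hx => bdistSteps_le_distTo i.Ω f.1 z₀ hx
  have hρf' : ∀ x, f'.1 x ≠ 0 → ρ' ≤ (distTo (Finset.univ.filter fun y : HiggsLattice.Site i.P 0 => y ∉ i.Ω) z₀ x : ℝ) :=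
    fun x hx => bdistSteps_le_distTo i.Ω f'.1 z₀ hx
  have hρbf : ∀ (μ' : Fin i.P.d) (b : HiggsLattice.PBond i.P 0), bf i.Ω μ' f.1 b ≠ 0 →
      ρ ≤ (distTo (Finset.univ.filter fun y : HiggsLattice.Site i.P 0 => y ∉ i.Ω) z₀ b.src : ℝ) :=
    fun μ' b hb => hρf b.src (bf_ne_zero hb)
  have hρbf' : ∀ (μ' : Fin i.P.d) (b : HiggsLattice.PBond i.P 0), bf i.Ω μ' f'.1 b ≠ 0 →
      ρ' ≤ (distTo (Finset.univ.filter fun y : HiggsLattice.Site i.P 0 => y ∉ i.Ω) z₀ b.src : ℝ) :=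
    fun μ' b hb => hρf' b.src (bf_ne_zero hb)
  have hbf0 : ∀ (μ' : Fin i.P.d) (φ : ScalarField i.P 0 N) (b : HiggsLattice.PBond i.P 0), ¬ Inside i.Ω b → bf i.Ω μ' φ b = 0 :=
    fun μ' φ b hb => bf_eq_zero_of_not_inside i.Ω μ' φ b hb
  have he0 : 0 ≤ Real.exp (-(δ * (ρ / (i.P.L : ℝ) ^ i.k))) := (Real.exp_pos _).le
  have he0' : 0 ≤ Real.exp (-(δ * (ρ' / (i.P.L : ℝ) ^ i.k))) := (Real.exp_pos _).le
  have hF := Real.sqrt_nonneg (siteInner f.1 f.1)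
  have hF' := Real.sqrt_nonneg (siteInner f'.1 f'.1)
  have hD : ∀ u w : ScalarField i.P 0 N, covDeriv C i.A (u - w) = fun b => covDeriv C i.A u b - covDeriv C i.A w b :=
    fun u w => funext fun b => covDeriv_sub C i.A u w b
  match n with
  | 0 =>
    simp only [Cor23Idx.pairT, LinearMap.sub_apply, siteInner_sub_right]
    have H := deltaG_pairing_regular_region C i.A i.hk i.Ω i.Ω₀ i.hΩ i.hΩ₀ i.hsub z₀ hmsq hak hγ hlow hlow₀ hδ0 hδ1 hδ 1 le_rfl
      f.1 f'.1 f.2 f'.2 ρ ρ' hρf hρf'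
    rw [hT] at H
    have hKeq : 4 / γ + (2 * Real.sqrt i.P.d * (2 / Real.sqrt γ + 4 * Real.sqrt i.P.d * δ / γ) * (2 / γ) * Real.exp δ) / ((1 : ℕ) : ℝ)
          + 2 / ((1 : ℕ) : ℝ) * B1.aSeq a i.P.L i.k * (2 / γ) ^ 2
        = kbd0 γ i.P.d δ (B1.aSeq a i.P.L i.k) := by
      unfold kbd0; push_cast; ring
    rw [hKeq] at H
    refine H.trans ?_
    calc kbd0 γ i.P.d δ (B1.aSeq a i.P.L i.k) * Real.exp (8 * δ) * i.P.mesh i.k ^ 2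
          * Real.exp (-(δ * (ρ / (i.P.L : ℝ) ^ i.k))) * Real.exp (-(δ * (ρ' / (i.P.L : ℝ) ^ i.k)))
          * Real.sqrt (siteInner f.1 f.1) * Real.sqrt (siteInner f'.1 f'.1)
        ≤ kbd γ i.P.d δ a * Real.exp (8 * δ)
          * Real.exp (-(δ * (ρ / (i.P.L : ℝ) ^ i.k))) * Real.exp (-(δ * (ρ' / (i.P.L : ℝ) ^ i.k)))
          * Real.sqrt (siteInner f.1 f.1) * Real.sqrt (siteInner f'.1 f'.1) :=
          final_weak hk0 hk0le hT0 (sq_nonneg _) hM2 he0 he0' hF le_rfl hF' le_rfl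
  | 1 =>
    simp only [Cor23Idx.pairT, LinearMap.sub_apply]
    rw [hD, bondInner_sub_right]
    have H := deltaG_pairing_DG_regular_region C i.A i.hk i.Ω i.Ω₀ i.hΩ i.hΩ₀ i.hsub z₀ hmsq hak hγ hlow hlow₀ hδ0 hδ1 hδ 1 le_rfl
      (bf i.Ω μ f.1) (hbf0 μ f.1) f'.1 f'.2 ρ ρ' (hρbf μ) hρf'
    rw [hT] at H
    have hKeq : (2 / Real.sqrt γ + 4 * Real.sqrt i.P.d * δ / γ) * (Real.exp δ + Real.exp δ ^ 3)
          + 1 / ((1 : ℕ) : ℝ) * Real.sqrt i.P.d *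
              (Real.exp δ ^ 2 * ((4 + 2 * δ * Real.sqrt (8 * i.P.d / γ)) * (2 / γ) + (2 / Real.sqrt γ + 4 * Real.sqrt i.P.d * δ / γ) ^ 2)
                + 2 / γ)
          + 2 * (1 / ((1 : ℕ) : ℝ)) * B1.aSeq a i.P.L i.k * (2 / Real.sqrt γ + 4 * Real.sqrt i.P.d * δ / γ) * Real.exp δ * (2 / γ)
        = kbd1 γ i.P.d δ (B1.aSeq a i.P.L i.k) := by
      unfold kbd1; push_cast; ring
    rw [hKeq] at H
    refine H.trans ?_
    exact final_weak hk1 hk1le hT0 hM0 hM1 he0 he0' (Real.sqrt_nonneg _) (sqrt_bondInner_bf_le i.Ω μ f.1) hF' le_rfl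
  | 2 =>
    simp only [Cor23Idx.pairT, LinearMap.sub_apply, siteInner_sub_right]
    have H := deltaG_pairing_GDt_regular_region C i.A i.hk i.Ω i.Ω₀ i.hΩ i.hΩ₀ i.hsub z₀ hmsq hak hγ hlow hlow₀ hδ0 hδ1 hδ 1 le_rfl
      f.1 f.2 (bf i.Ω ν f'.1) (hbf0 ν f'.1) ρ ρ' hρf (hρbf' ν)
    rw [hT] at H
    have hKeq : (2 / Real.sqrt γ + 4 * Real.sqrt i.P.d * δ / γ) * (Real.exp δ + Real.exp δ ^ 3)
          + 1 / ((1 : ℕ) : ℝ) * Real.sqrt i.P.d *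
              (Real.exp δ ^ 2 * ((4 + 2 * δ * Real.sqrt (8 * i.P.d / γ)) * (2 / γ) + (2 / Real.sqrt γ + 4 * Real.sqrt i.P.d * δ / γ) ^ 2)
                + 2 / γ)
          + 2 * (1 / ((1 : ℕ) : ℝ)) * B1.aSeq a i.P.L i.k * (2 / Real.sqrt γ + 4 * Real.sqrt i.P.d * δ / γ) * Real.exp δ * (2 / γ)
        = kbd1 γ i.P.d δ (B1.aSeq a i.P.L i.k) := by
      unfold kbd1; push_cast; ring
    rw [hKeq] at H
    refine H.trans ?_
    exact final_weak hk1 hk1le hT0 hM0 hM1 he0 he0' hF le_rfl (Real.sqrt_nonneg _) (sqrt_bondInner_bf_le i.Ω ν f'.1)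
  | 3 =>
    simp only [Cor23Idx.pairT, LinearMap.sub_apply]
    rw [hD, bondInner_sub_right]
    have H := deltaG_pairing_DGDt_regular_region C i.A i.hk i.Ω i.Ω₀ i.hΩ i.hΩ₀ i.hsub z₀ hmsq hak hγ hlow hlow₀ hδ0 hδ1 hδ 1 le_rfl
      (bf i.Ω μ f.1) (bf i.Ω ν f'.1) (hbf0 μ f.1) (hbf0 ν f'.1) ρ ρ' (hρbf μ) (hρbf' ν)
    rw [hT] at H
    have hKeq : (4 + 2 * δ * Real.sqrt (8 * i.P.d / γ)) * (Real.exp δ ^ 3 + Real.exp δ ^ 4)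
          + 1 / ((1 : ℕ) : ℝ) * Real.sqrt i.P.d * (2 / Real.sqrt γ + 4 * Real.sqrt i.P.d * δ / γ) * Real.exp δ *
              (2 * (4 + 2 * δ * Real.sqrt (8 * i.P.d / γ)) * Real.exp δ ^ 2 + 2)
          + 2 * (1 / ((1 : ℕ) : ℝ)) * B1.aSeq a i.P.L i.k * (2 / Real.sqrt γ + 4 * Real.sqrt i.P.d * δ / γ) ^ 2 * Real.exp δ ^ 2
        = kbd3 γ i.P.d δ (B1.aSeq a i.P.L i.k) := by
      unfold kbd3; push_cast; ring
    rw [hKeq] at H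
    refine H.trans ?_
    have h1 : kbd3 γ i.P.d δ (B1.aSeq a i.P.L i.k) * Real.exp (8 * δ)
          * Real.exp (-(δ * (ρ / (i.P.L : ℝ) ^ i.k))) * Real.exp (-(δ * (ρ' / (i.P.L : ℝ) ^ i.k)))
          * Real.sqrt (bondInner (bf i.Ω μ f.1) (bf i.Ω μ f.1)) * Real.sqrt (bondInner (bf i.Ω ν f'.1) (bf i.Ω ν f'.1))
        = kbd3 γ i.P.d δ (B1.aSeq a i.P.L i.k) * Real.exp (8 * δ) * 1
          * Real.exp (-(δ * (ρ / (i.P.L : ℝ) ^ i.k))) * Real.exp (-(δ * (ρ' / (i.P.L : ℝ) ^ i.k)))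
          * Real.sqrt (bondInner (bf i.Ω μ f.1) (bf i.Ω μ f.1)) * Real.sqrt (bondInner (bf i.Ω ν f'.1) (bf i.Ω ν f'.1)) := by ring
    rw [h1]
    exact final_weak hk3 hk3le hT0 zero_le_one le_rfl he0 he0' (Real.sqrt_nonneg _) (sqrt_bondInner_bf_le i.Ω μ f.1)
      (Real.sqrt_nonneg _) (sqrt_bondInner_bf_le i.Ω ν f'.1)

end Boundary

/-! ## §5 The typed Corollary 2.3 on the nested family -/

section Main

variable {d L : ℕ}

/-- weakening a decay bound: `Z ≤ c·e^{−p}·Q`, `c ≤ c′`, `b ≤ p` ⇒ `Z ≤ c′·e^{−b}·Q`. [folklore] -/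
private theorem decay_weaken {Z c c' p b Q : ℝ} (hc : 0 ≤ c) (hcc : c ≤ c') (hQ : 0 ≤ Q) (hZ : Z ≤ c * Real.exp (-p) * Q)
    (hb : b ≤ p) : Z ≤ c' * Real.exp (-b) * Q := by
  refine hZ.trans ?_
  have h1 : Real.exp (-p) ≤ Real.exp (-b) := Real.exp_le_exp.2 (by linarith)
  have hc' : 0 ≤ c' := hc.trans hcc
  calc c * Real.exp (-p) * Q ≤ c' * Real.exp (-b) * Q := by gcongr

/-- the `min`-combination of two decay bounds: `Z ≤ c_X·e^{−p}·Q`, `Z ≤ c_Y·e^{−q}·Q`, `b ≤ (p+q)/2` ⇒ `Z ≤ (c_X + c_Y)·e^{−b}·Q`. [folklore] -/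
private theorem min_decay_le {Z cX cY p q Q b : ℝ} (hcX : 0 ≤ cX) (hcY : 0 ≤ cY) (hQ : 0 ≤ Q)
    (hX : Z ≤ cX * Real.exp (-p) * Q) (hY : Z ≤ cY * Real.exp (-q) * Q) (hb : b ≤ (p + q) / 2) :
    Z ≤ (cX + cY) * Real.exp (-b) * Q := by
  rcases le_total p q with h | h
  · -- q ≥ (p+q)/2 ≥ b : use the Y bound
    exact decay_weaken hcY (by linarith) hQ hY (by linarith)
  · exact decay_weaken hcX (by linarith) hQ hX (by linarith)

set_option maxHeartbeats 1600000 in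
/-- **[13] COROLLARY 2.3, BOTH SENTENCES, IN b04's TYPED FORM `B4.Cor23Printed`, ON THE CONCRETE-CARRIER FAMILY OF NESTED PAIRS `regNestedFam23`**:
for `d`, `L ≧ 2`, `a > 0`, `m² > 0`, `N`, `(e, q)`, `c ≧ 0`, `β > 0` there are `c₀, δ₀, e₁ > 0` such that EVERY member (torus with these `d, L`, level with
`L^kε ≤ 1`, block-union regions `Ω ⊆ Ω₀`, field `A`, coupling `e_k`) which is (2.23)-regular at the sites of `Ω₀` with `0 < e_k ≦ e₁` satisfies all four
pairing bounds (2.30) `≤ c₀e^{−δ₀dist(supp f, supp f′)}‖f‖₂‖f′‖₂` for `G_k(Ω,A)` AND all four for `δG_k(Ω,Ω₀,A)` with the additional factor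
`e^{−δ₀(dist(supp f, Ωᶜ) + dist(supp f′, Ωᶜ))}`, for all `f, f′` defined on `Ω` and all directions.  Constants: `δ₀ = min{δ₁, δ₂, δ}/2` (`δ = γ₀/(4d + 4a)`,
`γ₀ = min{2, a(1 − L^{−2})/4}`), `c₀ = 3(c₁ + c₂)e^{δ₂} + kbd(γ₀, d, δ, a)e^{8δ}`, `e₁ = (3(d²c + 1))^{−1/β}`.
[cite: Balaban1983RegularityDecay, Cor. 2.3 (2.30) pp.580–581] [cite: Balaban1982Higgs1, Prop. 2.1 (2.23) p.610] -/
theorem cor23Printed_regNestedFam23 (d L : ℕ) (hL : 2 ≤ L) {a : ℝ} (ha : 0 < a) {msq : ℝ} (hmsq : 0 < msq) (C : ChargeData N)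
    {creg : ℝ} (hcreg : 0 ≤ creg) {β : ℝ} (hβ : 0 < β) :
    Cor23Printed (regNestedFam23 d L C a msq creg β) := by
  have hL1 : 1 < L := by omega
  have hL' : (1 : ℝ) < (L : ℝ) := by exact_mod_cast hL1
  obtain ⟨δ₁, c₁, hδ₁, hc₁, H1⟩ := cor23_first_regular_region d L hL1 ha
  obtain ⟨δ₂, c₂, hδ₂, hc₂, H2⟩ := cor23_deriv_regular_region d L hL1 ha
  obtain ⟨e₁, he₁, hsm⟩ := threshold_reg223 d hcreg hβ
  -- the coercivity constant and the admissible exponent of the δG bounds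
  have hinv : ((L : ℝ) ^ 2)⁻¹ < 1 := inv_lt_one_of_one_lt₀ (by nlinarith)
  set γ₀ : ℝ := min 2 (a * (1 - ((L : ℝ) ^ 2)⁻¹) / 4) with hγ₀
  have hγ₀pos : 0 < γ₀ := lt_min (by norm_num) (by nlinarith [mul_pos ha (show (0:ℝ) < 1 - ((L : ℝ) ^ 2)⁻¹ by linarith)])
  have hden : (0 : ℝ) < 4 * d + 4 * a := by positivity
  set δ : ℝ := γ₀ / (4 * d + 4 * a) with hδdef
  have hδpos : 0 < δ := div_pos hγ₀pos hden
  -- constants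
  set cP : ℝ := (c₁ + c₂) * Real.exp δ₂ with hcP
  have hcP0 : 0 < cP := by positivity
  set cY : ℝ := kbd γ₀ d δ a * Real.exp (8 * δ) with hcY
  have hkbd0 : 0 ≤ kbd γ₀ d δ a := by
    obtain ⟨h0, h1, h3, -, -, -⟩ := kbd_facts hγ₀pos d hδpos.le ha.le le_rfl
    unfold kbd; linarith
  have hcY0 : 0 ≤ cY := by positivity
  set δ₀ : ℝ := min (min δ₁ δ₂) δ / 2 with hδ₀
  have hδ₀pos : 0 < δ₀ := by positivity
  have hδ₀le₁ : δ₀ ≤ min δ₁ δ₂ := by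
    have : min (min δ₁ δ₂) δ ≤ min δ₁ δ₂ := min_le_left _ _
    have h2 : 0 ≤ min (min δ₁ δ₂) δ := le_min (le_min hδ₁.le hδ₂.le) hδpos.le
    rw [hδ₀]; linarith
  refine ⟨cP + (2 * cP + cY), δ₀, e₁, by positivity, hδ₀pos, he₁, ?_⟩
  intro i hreg _ hec hle n μ ν f f'
  dsimp only [regNestedFam23, regDiagFam23] at hreg hec hle f f' μ ν ⊢
  -- the member's torus has P.d = d, P.L = L
  have hPL1 : 1 < i.P.L := by rw [i.hPL]; exact hL1
  have hPL' : (1 : ℝ) < (i.P.L : ℝ) := by exact_mod_cast hPL1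
  have hLreal : ((i.P.L : ℝ)) = (L : ℝ) := by exact_mod_cast i.hPL
  have hLk : (1 : ℝ) ≤ (i.P.L : ℝ) ^ i.k := by exact_mod_cast Nat.one_le_pow _ _ i.P.hL
  have hLpos : (0 : ℝ) < (i.P.L : ℝ) ^ i.k := by linarith
  -- regularity in the δ_A currency on Ω₀ (and a fortiori on Ω)
  have hsmall : (i.P.d : ℝ) ^ 2 * creg * i.ec ^ β ≤ 1 / 3 := by rw [i.hPd]; exact hsm i.ec hec hle
  obtain ⟨δA, hregA₀, hsmallA⟩ := exists_deltaA_of_reg223 C i.Ω₀ i.A hec hreg hsmall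
  have hregA : ∀ z ∈ i.Ω, ∀ μ ν : Fin i.P.d, |i.A ⟨z.shift ν, μ⟩ - i.A ⟨z, μ⟩| ≤ δA :=
    fun z hz => hregA₀ z (i.hsub hz)
  -- the printed-shape pairing theorems at Ω and at Ω₀
  have H1Ω := H1 i.P i.hPd i.hPL N C msq hmsq i.k i.hk1 i.hk i.hs i.Ω i.hΩ i.A δA hregA hsmallA
  have H2Ω := H2 i.P i.hPd i.hPL N C msq hmsq i.k i.hk1 i.hk i.hs i.Ω i.hΩ i.A δA hregA hsmallA
  have H1Ω₀ := H1 i.P i.hPd i.hPL N C msq hmsq i.k i.hk1 i.hk i.hs i.Ω₀ i.hΩ₀ i.A δA hregA₀ hsmallA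
  have H2Ω₀ := H2 i.P i.hPd i.hPL N C msq hmsq i.k i.hk1 i.hk i.hs i.Ω₀ i.hΩ₀ i.A δA hregA₀ hsmallA
  clear H1 H2
  have hPΩ := pairT_le_of_pairings i.toCor23Idx C a msq i.Ω (fun x hx => hx) hc₁ hδ₂ hc₂ H1Ω H2Ω n μ ν f f'
  have hPΩ₀ := pairT_le_of_pairings i.toCor23Idx C a msq i.Ω₀ i.hsub hc₁ hδ₂ hc₂ H1Ω₀ H2Ω₀ n μ ν f f'
  -- shorthand for the member's decay data
  set s : ℝ := ssdistSteps f.1 f'.1 with hs_def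
  have hs0 : 0 ≤ s := by rw [hs_def]; unfold ssdistSteps; split_ifs <;> positivity
  set ρ : ℝ := bdistSteps i.Ω f.1 with hρ_def
  set ρ' : ℝ := bdistSteps i.Ω f'.1 with hρ'_def
  have hρ0 : 0 ≤ ρ := bdistSteps_nonneg _ _
  have hρ'0 : 0 ≤ ρ' := bdistSteps_nonneg _ _
  set Q : ℝ := Real.sqrt (siteInner f.1 f.1) * Real.sqrt (siteInner f'.1 f'.1) with hQ
  have hQ0 : 0 ≤ Q := mul_nonneg (Real.sqrt_nonneg _) (Real.sqrt_nonneg _)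
  have hsL : 0 ≤ s / (i.P.L : ℝ) ^ i.k := div_nonneg hs0 hLpos.le
  have hρL : 0 ≤ ρ / (i.P.L : ℝ) ^ i.k := div_nonneg hρ0 hLpos.le
  have hρ'L : 0 ≤ ρ' / (i.P.L : ℝ) ^ i.k := div_nonneg hρ'0 hLpos.le
  have hcPle : cP ≤ cP + (2 * cP + cY) := by linarith
  refine ⟨?_, ?_⟩
  · ---------------------------------------------------------------- the `pair` clause
    have hX : i.toCor23Idx.pairT C (propagatorK C i.Ω i.A msq a i.k) n μ ν f f'
        ≤ cP * Real.exp (-(min δ₁ δ₂ * (s / (i.P.L : ℝ) ^ i.k))) * Q := by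
      calc _ ≤ _ := hPΩ
        _ = _ := by rw [hcP, hQ]; ring
    have h := decay_weaken hcP0.le hcPle hQ0 hX (b := δ₀ * (s / (i.P.L : ℝ) ^ i.k)) (by nlinarith)
    calc _ ≤ _ := h
      _ = _ := by rw [hQ]; ring
  · ---------------------------------------------------------------- the `dpair` clause
    by_cases hΩc : (Finset.univ.filter fun y : HiggsLattice.Site i.P 0 => y ∉ i.Ω).Nonempty
    · obtain ⟨z₀, hz₀⟩ := hΩc
      -- coercivity on Ω and on Ω₀ with γ₀, admissible δ
      have hγP : min 2 (a * (1 - ((i.P.L : ℝ) ^ 2)⁻¹) / 4) = γ₀ := by rw [hγ₀, hLreal]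
      have hlow : ∀ w : ScalarField i.P 0 N, (∀ x, x ∉ i.Ω → w x = 0) →
          γ₀ * ((i.P.mesh i.k)⁻¹ ^ 2) * siteInner w w ≤ siteInner w (covOpK C i.Ω i.A msq a i.k w) := by
        intro w hw
        have h1 := coercive_covOpK_regular_region_uniform C (msq := msq) ha hPL1 i.hk1 i.hk i.Ω i.hΩ i.A hregA hsmallA w hw
        rw [hγP] at h1
        have : 0 ≤ msq * siteInner w w := mul_nonneg hmsq.le (siteInner_self_nonneg w)
        linarith
      have hlow₀ : ∀ w : ScalarField i.P 0 N, (∀ x, x ∉ i.Ω₀ → w x = 0) →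
          γ₀ * ((i.P.mesh i.k)⁻¹ ^ 2) * siteInner w w ≤ siteInner w (covOpK C i.Ω₀ i.A msq a i.k w) := by
        intro w hw
        have h1 := coercive_covOpK_regular_region_uniform C (msq := msq) ha hPL1 i.hk1 i.hk i.Ω₀ i.hΩ₀ i.A hregA₀ hsmallA w hw
        rw [hγP] at h1
        have : 0 ≤ msq * siteInner w w := mul_nonneg hmsq.le (siteInner_self_nonneg w)
        linarith
      have hδbud' : (4 * (i.P.d : ℝ) + 4 * a) * δ ≤ min 2 (a * (1 - ((i.P.L : ℝ) ^ 2)⁻¹) / 4) := by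
        rw [hγP, i.hPd, hδdef]
        exact le_of_eq (mul_div_cancel₀ _ hden.ne')
      obtain ⟨hδ1, hbud⟩ := delta_admissible (P := i.P) (k := i.k) ha hPL1 i.hk1 hδpos.le hδbud'
      rw [hγP] at hbud
      have hY0 := dpairT_le_boundary i C ha hPL1 hmsq hγ₀pos hlow hlow₀ hδpos.le hδ1 hbud ⟨z₀, hz₀⟩ n μ ν f f'
      rw [i.hPd] at hY0
      have hY : i.toCor23Idx.pairT C (propagatorK C i.Ω i.A msq a i.k - propagatorK C i.Ω₀ i.A msq a i.k) n μ ν f f'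
          ≤ cY * Real.exp (-(δ * (ρ / (i.P.L : ℝ) ^ i.k) + δ * (ρ' / (i.P.L : ℝ) ^ i.k))) * Q := by
        calc _ ≤ _ := hY0
          _ = _ := by rw [hcY, hQ, neg_add, Real.exp_add]; ring
      have hX : i.toCor23Idx.pairT C (propagatorK C i.Ω i.A msq a i.k - propagatorK C i.Ω₀ i.A msq a i.k) n μ ν f f'
          ≤ 2 * cP * Real.exp (-(min δ₁ δ₂ * (s / (i.P.L : ℝ) ^ i.k))) * Q := by
        calc _ ≤ _ := pairT_sub_le i.toCor23Idx C _ _ n μ ν f f'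
          _ ≤ _ := add_le_add hPΩ hPΩ₀
          _ = _ := by rw [hcP, hQ]; ring
      have hb : δ₀ * (s / (i.P.L : ℝ) ^ i.k) + δ₀ * (ρ / (i.P.L : ℝ) ^ i.k + ρ' / (i.P.L : ℝ) ^ i.k)
          ≤ (min δ₁ δ₂ * (s / (i.P.L : ℝ) ^ i.k) + (δ * (ρ / (i.P.L : ℝ) ^ i.k) + δ * (ρ' / (i.P.L : ℝ) ^ i.k))) / 2 := by
        have hδ₀le : δ₀ ≤ δ / 2 := by
          have : min (min δ₁ δ₂) δ ≤ δ := min_le_right _ _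
          rw [hδ₀]; linarith
        have hδ₀le' : δ₀ ≤ min δ₁ δ₂ / 2 := by
          have : min (min δ₁ δ₂) δ ≤ min δ₁ δ₂ := min_le_left _ _
          rw [hδ₀]; linarith
        nlinarith
      have h := min_decay_le (by positivity) hcY0 hQ0 hX hY hb
      have h' := decay_weaken (by positivity) (show 2 * cP + cY ≤ cP + (2 * cP + cY) by linarith) hQ0 h le_rfl
      calc _ ≤ _ := h'
        _ = _ := by rw [hQ, neg_add, Real.exp_add]; ring
    · -- Ωᶜ = ∅: Ω = T_ε = Ω₀ and δG = 0
      have hall : ∀ y, y ∈ i.Ω := by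
        intro y
        by_contra hy
        exact hΩc ⟨y, Finset.mem_filter.2 ⟨Finset.mem_univ _, hy⟩⟩
      have hΩeq : i.Ω₀ = i.Ω := Finset.Subset.antisymm (fun y _ => hall y) i.hsub
      rw [hΩeq, sub_self, pairT_zero]
      positivity

/-- **The family is non-vacuous at every threshold**: for every torus with these `d, L`, every level `1 ≤ k ≤ K` with `L^kε ≤ 1`, every nested pair
of block-union regions `Ω ⊆ Ω₀` and every `0 < e_k ≦ e₁` the member with `A = 0` is `regular` (and `bigBlocks`). [cite: Balaban1983RegularityDecay, Cor. 2.3 pp.580–581] -/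
theorem regNestedFam23_nonvacuous (C : ChargeData N) (a msq : ℝ) {creg : ℝ} (hcreg : 0 ≤ creg) (β : ℝ)
    (P : HiggsLattice.Params) (hPd : P.d = d) (hPL : P.L = L) {k : ℕ} (hk1 : 1 ≤ k) (hk : k ≤ P.K) (hs : P.mesh k ≤ 1)
    (Ω Ω₀ : Finset (HiggsLattice.Site P 0)) (hΩ : ∀ x x' : HiggsLattice.Site P 0, blockIter k x = blockIter k x' → (x ∈ Ω ↔ x' ∈ Ω))
    (hΩ₀ : ∀ x x' : HiggsLattice.Site P 0, blockIter k x = blockIter k x' → (x ∈ Ω₀ ↔ x' ∈ Ω₀)) (hsub : Ω ⊆ Ω₀)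
    {e₁ : ℝ} (he₁ : 0 < e₁) :
    ∃ i : Cor23NestedIdx d L,
      (regNestedFam23 d L C a msq creg β i).regular ∧ (regNestedFam23 d L C a msq creg β i).bigBlocks ∧
      0 < (regNestedFam23 d L C a msq creg β i).e ∧ (regNestedFam23 d L C a msq creg β i).e ≤ e₁ := by
  refine ⟨⟨⟨P, hPd, hPL, k, hk1, hk, hs, Ω, hΩ, 0, e₁⟩, Ω₀, hΩ₀, hsub⟩, ?_, trivial, he₁, le_rfl⟩
  dsimp only [regNestedFam23, regDiagFam23]
  intro z _ μ ν
  rw [Pi.zero_apply, Pi.zero_apply, sub_self, abs_zero, mul_zero]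
  have hL0 : (0 : ℝ) ≤ (P.L : ℝ) ^ k := by positivity
  exact div_nonneg (mul_nonneg hcreg (Real.rpow_nonneg he₁.le _)) hL0

end Main

end Literature.MathematicalPhysics.QuantumFieldTheory.Balaban1983to89.B1Cor23RegularNestedFam

end
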